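import Summits.KontsevichZagierPeriods.Zeta5Search.Barrier.ConeGammaTranslateJunctions

/-!
# ζ(5) search — BARRIER: THE EXCHANGE AT A SWAPPED PAIR OF CROSSINGS IS A UNIT — the mixed second difference of BZ's floor
# functional, and the two jumps of a double window (sequel to «THE CLOSED-ORBIT LIMIT»; away from the coherence ball)

HONEST FRAMING (cell `pub-zeta5`): systematic search; no irrationality claim unless kernel-certified. MODEL objects
under Brown–Zudilin's (28)+(30) accounting ([BZ22] = arXiv:2210.03391; (28) observed, not proved); nothing here is a
statement about `ζ(5)`, any `γ` of record, the cone's supremum (C2 OPEN) or any jump / wall / translate at a named direction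
(DATA of the cell); NO cancellation is quantified; S-E / (TD_A) stay CONJECTURED; records in print UNMOVED. Prover P2 g41 (SEQUEL
to the item «THE CLOSED-ORBIT LIMIT», its successor menu (c); plan INBOX 2026-08-28). Sources: P2 g40 `ConeGammaTranslateGradientLocal`
(the 1-D window lemmas `floor_line_eq_of_far`, `floor_line_crossing`; `torusN_congr_phiForm`), P2 g33 `ConeGammaCuspFloorPattern` /
`ConeGammaCuspPatternOriented` (`torusN_eq_floorN`, `floorN_step`: one floor up by one moves the floor value by a step in `{0,1}`
(`F`-form) or `{−1,0}` (`F^c`-form)), P2 g26 (`D_b ∈ {−1,0,+1}` at the junctions of the CLOSED orbit — the cusp's symmetric part).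

THE POINT. P2 g40's gradient theorem makes the translate integral `P` affine on every cell of the translate arrangement with
gradient the per-period signed jump masses `J_k`; the walls between cells are the RESONANCES, where two crossings `(k₁,z₁)`,
`(k₂,z₂)` of different forms happen at the same time. This file computes what the two jumps do when their ORDER is swapped:
* **`floorN_exchange_mem`** — for EVERY floor vector `N ∈ ℤ²⁸` and forms `k₁ ≠ k₂`, the mixed second difference
  `m = floorN(N + e₁ + e₂) − floorN(N + e₁) − floorN(N + e₂) + floorN(N)` lies in `{−1, 0, 1}` (`floorN_step` twice: both first
  differences in `k₁` lie in the same two-element set) — the combinatorial core, realisable or not;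
* `floor_double_window` — at a translate `δ` with a margin `r′` where `(k₁,z₁)`, `(k₂,z₂)` (`k₁ ≠ k₂`) cross at times
  `s₁ < s₂ ≤ s₁ + R/2` inside a DOUBLE WINDOW (every OTHER crossing at distance `≥ R` from `s₁`; `r′ ≤ R/2`; `R·x_max ≤ 1` —
  certificate-style), the 28 floors along `u ∈ [s₁ − r′/2, s₂]` are the frozen vector `N⁰` plus `e₁` once `u ≥ s₁` plus `e₂` once
  `u ≥ s₂`; **`jump_pair_eq_floorN`** — hence `J_{k₁,z₁} = floorN(N⁰+e₁) − floorN(N⁰)` and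
  `J_{k₂,z₂} = floorN(N⁰+e₁+e₂) − floorN(N⁰+e₁)`;
* **`jump_exchange_of_swap` — THE UNIT EXCHANGE**: two such translates `δ⁺` (`k₁` first) and `δ⁻` (`k₂` first) with the SAME
  frozen floors on their windows satisfy `J⁺_{k₁} + J⁺_{k₂} = J⁻_{k₁} + J⁻_{k₂}` and `J⁺_{k₁} − J⁻_{k₁} = −(J⁺_{k₂} − J⁻_{k₂}) = −m`,
  `|m| ≤ 1`: swapping two adjacent crossings EXCHANGES at most one unit between the two forms' jump masses and changes nothing
  in their sum — the kernel half of «every kink of `P` across a simple resonance wall is a unit kink `±(φ_{k₁}/h_{k₁} − φ_{k₂}/h_{k₂})`».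
NOT here (honest): that no OTHER jump of the period changes across the wall (g40's frozen-window argument, window by window —
not restated); the walls of a named direction; any value of `m`; `Φ`, `γ`, C2, S-E's truth, `ζ(5)`.
-/

noncomputable section

open Set MeasureTheory Finset
open scoped Topology

namespace Summit.KontsevichZagierPeriods.Zeta5Search.Barrier.ConeGamma

/-! ### The mixed second difference of the floor functional is a unit -/

/-- **THE MIXED SECOND DIFFERENCE OF THE FLOOR FUNCTIONAL IS IN `{−1, 0, 1}`.** For every `N ∈ ℤ²⁸` and `k₁ ≠ k₂`:
`floorN(N + e₁ + e₂) − floorN(N + e₁) − floorN(N + e₂) + floorN(N) ∈ [−1, 1]` (both `k₁`-differences lie in `{0,1}` if `k₁ ∈ F`,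
in `{−1,0}` if `k₁ ∉ F` — `floorN_step`). -/
theorem floorN_exchange_mem (N : Fin 28 → ℤ) {k₁ k₂ : Fin 28} (hk : k₁ ≠ k₂) :
    -1 ≤ (floorN (N + Pi.single k₁ 1 + Pi.single k₂ 1) - floorN (N + Pi.single k₂ 1)) -
        (floorN (N + Pi.single k₁ 1) - floorN N) ∧
      (floorN (N + Pi.single k₁ 1 + Pi.single k₂ 1) - floorN (N + Pi.single k₂ 1)) -
        (floorN (N + Pi.single k₁ 1) - floorN N) ≤ 1 := by
  -- first difference in `k₁` at `N`
  have h1 := floorN_step (N₁ := N) (N₂ := N + Pi.single k₁ 1) (k₀ := k₁) (by simp)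
    (fun k hk => by simp [Pi.single_eq_of_ne hk])
  -- first difference in `k₁` at `N + e₂`
  have h2 := floorN_step (N₁ := N + Pi.single k₂ 1) (N₂ := N + Pi.single k₁ 1 + Pi.single k₂ 1) (k₀ := k₁)
    (by simp [Pi.single_eq_of_ne hk])
    (fun k hk => by simp [Pi.single_eq_of_ne hk])
  by_cases hF : k₁ ∈ FIdx
  · obtain ⟨a1, a2⟩ := h1.1 hF
    obtain ⟨b1, b2⟩ := h2.1 hF
    constructor <;> linarith
  · obtain ⟨a1, a2⟩ := h1.2 hF
    obtain ⟨b1, b2⟩ := h2.2 hF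
    constructor <;> linarith

/-! ### The floors on a double window -/

/-- **THE 28 FLOORS ON A DOUBLE WINDOW.** All forms positive; `r′ > 0`; crossings `(k₁,z₁)`, `(k₂,z₂)` of
different forms at `s₁ < s₂` with `s₂ − s₁ ≤ R/2`, every OTHER crossing at distance `≥ R` from `s₁`, `r′ ≤ R/2`, `R·x_max(a) ≤ 1`.
Then for `u ∈ [s₁ − r′/2, s₂]` and every form `k`:
`⌊φ_k(θ_u)⌋ = N⁰_k + [k = k₁ ∧ s₁ ≤ u] + [k = k₂ ∧ s₂ ≤ u]`, `N⁰_{k₁} = z₁ − 1`, `N⁰_{k₂} = z₂ − 1`, `N⁰_k = ⌊s₁·h_k + φ_kδ⌋` otherwise. -/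
theorem floor_double_window {a : Dir} (hpos : ∀ k, 0 < h28 a k) {δ : Fin 8 → ℝ} {r' : ℝ} (hr' : 0 < r')
    {k₁ k₂ : Fin 28} (hk : k₁ ≠ k₂) {z₁ z₂ : ℤ} {R : ℝ}
    (hlt : ((z₁ : ℝ) - phiForm δ k₁) / h28 a k₁ < ((z₂ : ℝ) - phiForm δ k₂) / h28 a k₂)
    (hclose : ((z₂ : ℝ) - phiForm δ k₂) / h28 a k₂ - ((z₁ : ℝ) - phiForm δ k₁) / h28 a k₁ ≤ R / 2)
    (hrR : r' ≤ R / 2) (hRx : R * xMax a ≤ 1)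
    (hfar : ∀ (k : Fin 28) (z : ℤ), ¬(k = k₁ ∧ z = z₁) → ¬(k = k₂ ∧ z = z₂) →
      R ≤ |((z₁ : ℝ) - phiForm δ k₁) / h28 a k₁ - ((z : ℝ) - phiForm δ k) / h28 a k|)
    {u : ℝ} (hu1 : ((z₁ : ℝ) - phiForm δ k₁) / h28 a k₁ - r' / 2 ≤ u)
    (hu2 : u ≤ ((z₂ : ℝ) - phiForm δ k₂) / h28 a k₂) (k : Fin 28) :
    ⌊phiForm (u • sParam a + δ) k⌋ =
      (if k = k₁ then z₁ - 1 else if k = k₂ then z₂ - 1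
        else ⌊((z₁ : ℝ) - phiForm δ k₁) / h28 a k₁ * h28 a k + phiForm δ k⌋) +
      (if k = k₁ ∧ ((z₁ : ℝ) - phiForm δ k₁) / h28 a k₁ ≤ u then 1 else 0) +
      (if k = k₂ ∧ ((z₂ : ℝ) - phiForm δ k₂) / h28 a k₂ ≤ u then 1 else 0) := by
  set s₁ := ((z₁ : ℝ) - phiForm δ k₁) / h28 a k₁ with hs₁
  set s₂ := ((z₂ : ℝ) - phiForm δ k₂) / h28 a k₂ with hs₂
  have hx : 0 < xMax a := xMax_pos hpos
  have hR : 0 < R := by linarith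
  have hk' := hpos k
  -- `|u − s₁| < R`, and `|t|·h_k < 1` for such `t`
  have hus₁ : |u - s₁| < R := by rw [abs_lt]; constructor <;> linarith
  have hRk : R * h28 a k ≤ 1 := (mul_le_mul_of_nonneg_left (le_xMax a k) hR.le).trans hRx
  rw [phiForm_line]
  by_cases h1 : k = k₁
  · subst h1
    have hcross : s₁ * h28 a k + phiForm δ k = z₁ := by rw [hs₁, div_mul_cancel₀ _ hk'.ne']; ring
    have ht : |u - s₁| * h28 a k + |(0 : ℝ)| < 1 := by
      rw [abs_zero, add_zero]
      calc |u - s₁| * h28 a k < R * h28 a k := mul_lt_mul_of_pos_right hus₁ hk'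
        _ ≤ 1 := hRk
    obtain ⟨hfl, hcases⟩ := floor_line_crossing hk' hcross ht
    simp only [add_zero] at hfl hcases
    rw [show u * h28 a k + phiForm δ k = (s₁ + (u - s₁)) * h28 a k + phiForm δ k by ring, hfl]
    simp only [if_true, hk, false_and, if_false, add_zero, true_and]
    by_cases hsu : s₁ ≤ u
    · rw [if_pos hsu]
      have h0 : ⌊(u - s₁) * h28 a k⌋ = 0 := by
        rw [Int.floor_eq_zero_iff]
        refine ⟨mul_nonneg (by linarith) hk'.le, ?_⟩
        have := abs_of_nonneg (show 0 ≤ u - s₁ by linarith)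
        calc (u - s₁) * h28 a k = |u - s₁| * h28 a k := by rw [this]
          _ < 1 := by rw [abs_zero, add_zero] at ht; exact ht
      rw [h0]; ring
    · rw [if_neg hsu]
      push Not at hsu
      have hneg : (u - s₁) * h28 a k < 0 := mul_neg_of_neg_of_pos (by linarith) hk'
      have hm1 : ⌊(u - s₁) * h28 a k⌋ = -1 := by
        rcases hcases with h | h
        · exact h
        · exfalso
          have := Int.floor_eq_zero_iff.mp h
          linarith [this.1]
      rw [hm1]; ring
  · by_cases h2 : k = k₂
    · subst h2
      have hcross : s₂ * h28 a k + phiForm δ k = z₂ := by rw [hs₂, div_mul_cancel₀ _ hk'.ne']; ring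
      -- `1/h_k ≥ R + (s₂ − s₁)` from the far crossing `(k₂, z₂ − 1)`
      have hfar' := hfar k (z₂ - 1) (fun h => h1 h.1) (fun h => by
        have := h.2; omega)
      have egap : ((z₂ - 1 : ℤ) : ℝ) - phiForm δ k = (z₂ : ℝ) - phiForm δ k - 1 := by push_cast; ring
      have es : (((z₂ - 1 : ℤ) : ℝ) - phiForm δ k) / h28 a k = s₂ - 1 / h28 a k := by
        rw [egap, hs₂]; field_simp
      rw [es] at hfar'
      have hinv : R + (s₂ - s₁) ≤ 1 / h28 a k := by
        by_contra hcon
        push Not at hcon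
        -- then `|s₁ − (s₂ − 1/h)| < R`
        have h1' : 0 < 1 / h28 a k := by positivity
        have : |s₁ - (s₂ - 1 / h28 a k)| < R := by
          rw [abs_lt]; constructor <;> nlinarith
        linarith
      have ht : |u - s₂| * h28 a k + |(0 : ℝ)| < 1 := by
        rw [abs_zero, add_zero]
        have hus₂ : |u - s₂| < R + (s₂ - s₁) := by rw [abs_lt]; constructor <;> linarith
        calc |u - s₂| * h28 a k < (R + (s₂ - s₁)) * h28 a k := mul_lt_mul_of_pos_right hus₂ hk'
          _ ≤ 1 / h28 a k * h28 a k := mul_le_mul_of_nonneg_right hinv hk'.le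
          _ = 1 := by field_simp
      obtain ⟨hfl, hcases⟩ := floor_line_crossing hk' hcross ht
      simp only [add_zero] at hfl hcases
      rw [show u * h28 a k + phiForm δ k = (s₂ + (u - s₂)) * h28 a k + phiForm δ k by ring, hfl]
      simp only [h1, if_false, if_true, false_and, true_and]
      by_cases hsu : s₂ ≤ u
      · rw [if_pos hsu]
        have hu0 : u = s₂ := le_antisymm hu2 hsu
        rw [hu0, sub_self, zero_mul, Int.floor_zero]; ring
      · rw [if_neg hsu]
        push Not at hsu
        have hneg : (u - s₂) * h28 a k < 0 := mul_neg_of_neg_of_pos (by linarith) hk'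
        have hm1 : ⌊(u - s₂) * h28 a k⌋ = -1 := by
          rcases hcases with h | h
          · exact h
          · exfalso
            have := Int.floor_eq_zero_iff.mp h
            linarith [this.1]
        rw [hm1]; ring
    · -- a frozen form
      simp only [h1, h2, if_false, false_and, add_zero]
      have hfar' : ∀ z : ℤ, R ≤ |s₁ - ((z : ℝ) - phiForm δ k) / h28 a k| := fun z =>
        hfar k z (fun h => h1 h.1) (fun h => h2 h.1)
      have ht : |u - s₁| * h28 a k + |(0 : ℝ)| < R * h28 a k := by
        rw [abs_zero, add_zero]; exact mul_lt_mul_of_pos_right hus₁ hk'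
      have h := floor_line_eq_of_far hk' hfar' ht
      rw [add_zero] at h
      rw [show u * h28 a k + phiForm δ k = (s₁ + (u - s₁)) * h28 a k + phiForm δ k by ring, h]

/-- **THE TWO JUMPS OF A DOUBLE WINDOW.** Under the hypotheses of `floor_double_window` (margin `r′` of `δ`; `(k₁,z₁)` crosses
at `s₁`, `(k₂,z₂)` at `s₂`, `s₁ < s₂ ≤ s₁ + R/2`, every other crossing `≥ R` from `s₁`, `r′ ≤ R/2`, `R·x_max ≤ 1`): with the frozen
vector `N⁰` (`N⁰_{k₁} = z₁ − 1`, `N⁰_{k₂} = z₂ − 1`, `N⁰_k = ⌊s₁·h_k + φ_kδ⌋` otherwise),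
`J_{k₁,z₁} = floorN(N⁰ + e₁) − floorN(N⁰)` and `J_{k₂,z₂} = floorN(N⁰ + e₁ + e₂) − floorN(N⁰ + e₁)`. -/
theorem jump_pair_eq_floorN {a : Dir} (hpos : ∀ k, 0 < h28 a k) {δ : Fin 8 → ℝ} {r' : ℝ} (hr' : 0 < r')
    (hsep : ∀ (k k' : Fin 28) (z z' : ℤ), (k ≠ k' ∨ z ≠ z') →
      r' ≤ |((z : ℝ) - phiForm δ k) / h28 a k - ((z' : ℝ) - phiForm δ k') / h28 a k'|)
    {k₁ k₂ : Fin 28} (hk : k₁ ≠ k₂) {z₁ z₂ : ℤ} {R : ℝ}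
    (hlt : ((z₁ : ℝ) - phiForm δ k₁) / h28 a k₁ < ((z₂ : ℝ) - phiForm δ k₂) / h28 a k₂)
    (hclose : ((z₂ : ℝ) - phiForm δ k₂) / h28 a k₂ - ((z₁ : ℝ) - phiForm δ k₁) / h28 a k₁ ≤ R / 2)
    (hrR : r' ≤ R / 2) (hRx : R * xMax a ≤ 1)
    (hfar : ∀ (k : Fin 28) (z : ℤ), ¬(k = k₁ ∧ z = z₁) → ¬(k = k₂ ∧ z = z₂) →
      R ≤ |((z₁ : ℝ) - phiForm δ k₁) / h28 a k₁ - ((z : ℝ) - phiForm δ k) / h28 a k|)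
    {N : Fin 28 → ℤ}
    (hN : ∀ k, N k = if k = k₁ then z₁ - 1 else if k = k₂ then z₂ - 1
      else ⌊((z₁ : ℝ) - phiForm δ k₁) / h28 a k₁ * h28 a k + phiForm δ k⌋) :
    torusN ((((z₁ : ℝ) - phiForm δ k₁) / h28 a k₁) • sParam a + δ) -
        torusN ((((z₁ : ℝ) - phiForm δ k₁) / h28 a k₁ - r' / 2) • sParam a + δ) =
      floorN (N + Pi.single k₁ 1) - floorN N ∧
    torusN ((((z₂ : ℝ) - phiForm δ k₂) / h28 a k₂) • sParam a + δ) -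
        torusN ((((z₂ : ℝ) - phiForm δ k₂) / h28 a k₂ - r' / 2) • sParam a + δ) =
      floorN (N + Pi.single k₁ 1 + Pi.single k₂ 1) - floorN (N + Pi.single k₁ 1) := by
  set s₁ := ((z₁ : ℝ) - phiForm δ k₁) / h28 a k₁ with hs₁
  set s₂ := ((z₂ : ℝ) - phiForm δ k₂) / h28 a k₂ with hs₂
  -- the margin separates the two crossings: `s₂ − s₁ ≥ r′`
  have hgap : r' ≤ s₂ - s₁ := by
    have h := hsep k₂ k₁ z₂ z₁ (Or.inl (Ne.symm hk))
    rwa [abs_of_pos (by linarith)] at h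
  -- the four floor vectors
  have ev : ∀ (u : ℝ), s₁ - r' / 2 ≤ u → u ≤ s₂ → torusN (u • sParam a + δ) =
      floorN (N + (if s₁ ≤ u then Pi.single k₁ 1 else 0) + (if s₂ ≤ u then Pi.single k₂ 1 else 0)) := by
    intro u hu1 hu2
    rw [torusN_eq_floorN]
    congr 1
    funext k
    rw [floor_double_window hpos hr' hk hlt hclose hrR hRx hfar hu1 hu2 k]
    simp only [Pi.add_apply]
    rw [hN k]
    have e1 : (if s₁ ≤ u then (Pi.single k₁ (1 : ℤ) : Fin 28 → ℤ) else 0) k =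
        if k = k₁ ∧ s₁ ≤ u then 1 else 0 := by
      by_cases hsu : s₁ ≤ u
      · by_cases h : k = k₁
        · subst h; simp [hsu]
        · simp [hsu, h]
      · by_cases h : k = k₁ <;> simp [hsu, h]
    have e2 : (if s₂ ≤ u then (Pi.single k₂ (1 : ℤ) : Fin 28 → ℤ) else 0) k =
        if k = k₂ ∧ s₂ ≤ u then 1 else 0 := by
      by_cases hsu : s₂ ≤ u
      · by_cases h : k = k₂
        · subst h; simp [hsu]
        · simp [hsu, h]
      · by_cases h : k = k₂ <;> simp [hsu, h]
    rw [e1, e2]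
  have e0 := ev (s₁ - r' / 2) le_rfl (by linarith)
  have e1 := ev s₁ (by linarith) hlt.le
  have e2 := ev (s₂ - r' / 2) (by linarith) (by linarith)
  have e3 := ev s₂ (by linarith) le_rfl
  rw [if_neg (by linarith), if_neg (by linarith), add_zero, add_zero] at e0
  rw [if_pos le_rfl, if_neg (by linarith), add_zero] at e1
  rw [if_pos (by linarith), if_neg (by linarith), add_zero] at e2
  rw [if_pos hlt.le, if_pos le_rfl] at e3
  exact ⟨by rw [e1, e0], by rw [e3, e2]⟩

/-! ### The unit exchange -/

/-- **THE UNIT EXCHANGE AT A SWAPPED PAIR.** Two translates `δ⁺`, `δ⁻` with margins `r⁺`, `r⁻`; in `δ⁺` the crossing `(k₁,z₁)`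
precedes `(k₂,z₂)` inside a double window (radius `R⁺`), in `δ⁻` the crossing `(k₂,z₂)` precedes `(k₁,z₁)` inside a double window
(radius `R⁻`); the frozen floors of the two windows AGREE (`hagree`: `⌊s₁⁺·h_k + φ_kδ⁺⌋ = ⌊s₂⁻·h_k + φ_kδ⁻⌋` for `k ∉ {k₁,k₂}`).
Then the SUM of the two jumps is the same on both sides, and the individual jumps differ by an exchange of `m ∈ {−1,0,1}`:
`J⁺_{k₁,z₁} + J⁺_{k₂,z₂} = J⁻_{k₁,z₁} + J⁻_{k₂,z₂}`, `J⁺_{k₁,z₁} − J⁻_{k₁,z₁} = −(J⁺_{k₂,z₂} − J⁻_{k₂,z₂})`, `|J⁺_{k₁,z₁} − J⁻_{k₁,z₁}| ≤ 1`. -/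
theorem jump_exchange_of_swap {a : Dir} (hpos : ∀ k, 0 < h28 a k) {k₁ k₂ : Fin 28} (hk : k₁ ≠ k₂) {z₁ z₂ : ℤ}
    {δp : Fin 8 → ℝ} {rp : ℝ} (hrp : 0 < rp)
    (hsepp : ∀ (k k' : Fin 28) (z z' : ℤ), (k ≠ k' ∨ z ≠ z') →
      rp ≤ |((z : ℝ) - phiForm δp k) / h28 a k - ((z' : ℝ) - phiForm δp k') / h28 a k'|)
    {Rp : ℝ} (hltp : ((z₁ : ℝ) - phiForm δp k₁) / h28 a k₁ < ((z₂ : ℝ) - phiForm δp k₂) / h28 a k₂)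
    (hclosep : ((z₂ : ℝ) - phiForm δp k₂) / h28 a k₂ - ((z₁ : ℝ) - phiForm δp k₁) / h28 a k₁ ≤ Rp / 2)
    (hrRp : rp ≤ Rp / 2) (hRxp : Rp * xMax a ≤ 1)
    (hfarp : ∀ (k : Fin 28) (z : ℤ), ¬(k = k₁ ∧ z = z₁) → ¬(k = k₂ ∧ z = z₂) →
      Rp ≤ |((z₁ : ℝ) - phiForm δp k₁) / h28 a k₁ - ((z : ℝ) - phiForm δp k) / h28 a k|)
    {δm : Fin 8 → ℝ} {rm : ℝ} (hrm : 0 < rm)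
    (hsepm : ∀ (k k' : Fin 28) (z z' : ℤ), (k ≠ k' ∨ z ≠ z') →
      rm ≤ |((z : ℝ) - phiForm δm k) / h28 a k - ((z' : ℝ) - phiForm δm k') / h28 a k'|)
    {Rm : ℝ} (hltm : ((z₂ : ℝ) - phiForm δm k₂) / h28 a k₂ < ((z₁ : ℝ) - phiForm δm k₁) / h28 a k₁)
    (hclosem : ((z₁ : ℝ) - phiForm δm k₁) / h28 a k₁ - ((z₂ : ℝ) - phiForm δm k₂) / h28 a k₂ ≤ Rm / 2)
    (hrRm : rm ≤ Rm / 2) (hRxm : Rm * xMax a ≤ 1)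
    (hfarm : ∀ (k : Fin 28) (z : ℤ), ¬(k = k₂ ∧ z = z₂) → ¬(k = k₁ ∧ z = z₁) →
      Rm ≤ |((z₂ : ℝ) - phiForm δm k₂) / h28 a k₂ - ((z : ℝ) - phiForm δm k) / h28 a k|)
    (hagree : ∀ k, k ≠ k₁ → k ≠ k₂ →
      ⌊((z₁ : ℝ) - phiForm δp k₁) / h28 a k₁ * h28 a k + phiForm δp k⌋ =
        ⌊((z₂ : ℝ) - phiForm δm k₂) / h28 a k₂ * h28 a k + phiForm δm k⌋) :
    (torusN ((((z₁ : ℝ) - phiForm δp k₁) / h28 a k₁) • sParam a + δp) -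
          torusN ((((z₁ : ℝ) - phiForm δp k₁) / h28 a k₁ - rp / 2) • sParam a + δp)) +
        (torusN ((((z₂ : ℝ) - phiForm δp k₂) / h28 a k₂) • sParam a + δp) -
          torusN ((((z₂ : ℝ) - phiForm δp k₂) / h28 a k₂ - rp / 2) • sParam a + δp)) =
      (torusN ((((z₁ : ℝ) - phiForm δm k₁) / h28 a k₁) • sParam a + δm) -
          torusN ((((z₁ : ℝ) - phiForm δm k₁) / h28 a k₁ - rm / 2) • sParam a + δm)) +
        (torusN ((((z₂ : ℝ) - phiForm δm k₂) / h28 a k₂) • sParam a + δm) -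
          torusN ((((z₂ : ℝ) - phiForm δm k₂) / h28 a k₂ - rm / 2) • sParam a + δm)) ∧
    (torusN ((((z₁ : ℝ) - phiForm δp k₁) / h28 a k₁) • sParam a + δp) -
          torusN ((((z₁ : ℝ) - phiForm δp k₁) / h28 a k₁ - rp / 2) • sParam a + δp)) -
        (torusN ((((z₁ : ℝ) - phiForm δm k₁) / h28 a k₁) • sParam a + δm) -
          torusN ((((z₁ : ℝ) - phiForm δm k₁) / h28 a k₁ - rm / 2) • sParam a + δm)) =
      -((torusN ((((z₂ : ℝ) - phiForm δp k₂) / h28 a k₂) • sParam a + δp) -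
          torusN ((((z₂ : ℝ) - phiForm δp k₂) / h28 a k₂ - rp / 2) • sParam a + δp)) -
        (torusN ((((z₂ : ℝ) - phiForm δm k₂) / h28 a k₂) • sParam a + δm) -
          torusN ((((z₂ : ℝ) - phiForm δm k₂) / h28 a k₂ - rm / 2) • sParam a + δm))) ∧
    |(torusN ((((z₁ : ℝ) - phiForm δp k₁) / h28 a k₁) • sParam a + δp) -
          torusN ((((z₁ : ℝ) - phiForm δp k₁) / h28 a k₁ - rp / 2) • sParam a + δp)) -
        (torusN ((((z₁ : ℝ) - phiForm δm k₁) / h28 a k₁) • sParam a + δm) -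
          torusN ((((z₁ : ℝ) - phiForm δm k₁) / h28 a k₁ - rm / 2) • sParam a + δm))| ≤ 1 := by
  -- the common frozen vector
  set N : Fin 28 → ℤ := fun k => if k = k₁ then z₁ - 1 else if k = k₂ then z₂ - 1
    else ⌊((z₁ : ℝ) - phiForm δp k₁) / h28 a k₁ * h28 a k + phiForm δp k⌋ with hNdef
  have hNp : ∀ k, N k = if k = k₁ then z₁ - 1 else if k = k₂ then z₂ - 1
      else ⌊((z₁ : ℝ) - phiForm δp k₁) / h28 a k₁ * h28 a k + phiForm δp k⌋ := fun k => rfl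
  have hNm : ∀ k, N k = if k = k₂ then z₂ - 1 else if k = k₁ then z₁ - 1
      else ⌊((z₂ : ℝ) - phiForm δm k₂) / h28 a k₂ * h28 a k + phiForm δm k⌋ := by
    intro k
    rw [hNp k]
    by_cases h1 : k = k₁
    · subst h1; simp [hk]
    · by_cases h2 : k = k₂
      · subst h2; simp [h1]
      · simp [h1, h2, hagree k h1 h2]
  obtain ⟨p1, p2⟩ := jump_pair_eq_floorN hpos hrp hsepp hk hltp hclosep hrRp hRxp hfarp hNp
  obtain ⟨m2, m1⟩ := jump_pair_eq_floorN hpos hrm hsepm (Ne.symm hk) hltm hclosem hrRm hRxm hfarm hNm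
  have hcomm : N + Pi.single k₂ 1 + Pi.single k₁ 1 = N + Pi.single k₁ 1 + Pi.single k₂ 1 := add_right_comm _ _ _
  rw [hcomm] at m1
  obtain ⟨hlo, hhi⟩ := floorN_exchange_mem N hk
  rw [p1, p2, m1, m2]
  refine ⟨by ring, by ring, ?_⟩
  rw [abs_le]
  constructor <;> linarith

end Summit.KontsevichZagierPeriods.Zeta5Search.Barrier.ConeGamma

end
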